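import Literature.Computability.Cryptography.LWEPrimePowerLayout
import Literature.Computability.Cryptography.LWEPrimePowerProgOps
import HarnessLib

/-!
# The Micciancio–Peikert machine, index bookkeeping: nested blocks, segments and coin chunks as explicit positions; slices, chunks and indexed maps of `List.ofFn`

Topic `Computability/Cryptography` (LWE), grouping namespace `LWE.MP12.Prog`, bridge toolkit between
`LWEPrimePowerLayout.lean` (the flat layout: `blocksOf`, `blocks₂/₃/₄`, `split2/3/4/8`, `scalarsOf`,
`chunkVal`) and the list-level program (`LWEPrimePowerProgOps.lean`: `sliceAt`, `chunks`,
`scalarAt`). Proved material (no named fact) towards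
`Literature.Computability.Cryptography.blprs_gapSVP_sqrt_dim_to_lwe_classical` (**pqc.S21**),
hypothesis `h₂`: every accessor of the layout is the flat stream at an EXPLICIT position, and the
list operations on `List.ofFn` of the stream read the same positions.

## References

* S. Arora, B. Barak, *Computational Complexity: A Modern Approach*, CUP 2009, §1.3. [AroraBarak2009]
-/

namespace Literature.Computability.Cryptography

namespace LWE

namespace MP12

namespace Prog

open _root_.Computability Literature.Computability.Complexity

/-! ### Layout accessors as explicit positions -/

section Positions

variable {α : Type}

/-- `blocksOf K u v g j = v (g·u + j)`. [folklore] -/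
theorem blocksOf_eq (K u : ℕ) (v : Fin (K * u) → α) (g : Fin K) (j : Fin u) :
    blocksOf K u v g j = v ⟨g.val * u + j.val, by
      calc g.val * u + j.val < g.val * u + u := by omega
        _ = (g.val + 1) * u := by ring
        _ ≤ K * u := Nat.mul_le_mul_right u g.2⟩ := by
  unfold blocksOf
  congr 1
  exact Fin.ext (by rw [finProdFinEquiv_apply_val]; ring)

/-- Index bound for two levels of blocks. [folklore] -/
theorem idx₂_lt {a b c : ℕ} (i : Fin a) (j : Fin b) (k : Fin c) : (i.val * b + j.val) * c + k.val < a * (b * c) :=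
  calc (i.val * b + j.val) * c + k.val < (i.val * b + j.val) * c + c := by omega
    _ = (i.val * b + j.val + 1) * c := by ring
    _ ≤ (i.val * b + b) * c := Nat.mul_le_mul_right c (by omega)
    _ = ((i.val + 1) * b) * c := by ring
    _ ≤ (a * b) * c := Nat.mul_le_mul_right c (Nat.mul_le_mul_right b i.2)
    _ = a * (b * c) := by ring

/-- `blocks₂ a b c v i j k = v ((i·b + j)·c + k)`. [folklore] -/
theorem blocks₂_eq (a b c : ℕ) (v : Fin (a * (b * c)) → α) (i : Fin a) (j : Fin b) (k : Fin c) :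
    blocks₂ a b c v i j k = v ⟨(i.val * b + j.val) * c + k.val, idx₂_lt i j k⟩ := by
  unfold blocks₂
  rw [blocksOf_eq, blocksOf_eq]
  congr 1
  exact Fin.ext (by simp; ring)

/-- Index bound for three levels of blocks. [folklore] -/
theorem idx₃_lt {a b c d : ℕ} (i : Fin a) (j : Fin b) (k : Fin c) (q : Fin d) :
    ((i.val * b + j.val) * c + k.val) * d + q.val < a * (b * (c * d)) := by
  have h := idx₂_lt i j k
  calc ((i.val * b + j.val) * c + k.val) * d + q.val < ((i.val * b + j.val) * c + k.val) * d + d := by omega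
    _ = ((i.val * b + j.val) * c + k.val + 1) * d := by ring
    _ ≤ (a * (b * c)) * d := Nat.mul_le_mul_right d h
    _ = a * (b * (c * d)) := by ring

/-- `blocks₃ a b c d v i j k q = v (((i·b + j)·c + k)·d + q)`. [folklore] -/
theorem blocks₃_eq (a b c d : ℕ) (v : Fin (a * (b * (c * d))) → α) (i : Fin a) (j : Fin b) (k : Fin c) (q : Fin d) :
    blocks₃ a b c d v i j k q = v ⟨((i.val * b + j.val) * c + k.val) * d + q.val, idx₃_lt i j k q⟩ := by
  unfold blocks₃
  rw [blocks₂_eq, blocksOf_eq]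
  congr 1
  exact Fin.ext (by simp; ring)

/-- Index bound for four levels of blocks. [folklore] -/
theorem idx₄_lt {a b c d f : ℕ} (i : Fin a) (j : Fin b) (k : Fin c) (l : Fin d) (q : Fin f) :
    (((i.val * b + j.val) * c + k.val) * d + l.val) * f + q.val < a * (b * (c * (d * f))) := by
  have h := idx₃_lt i j k l
  calc (((i.val * b + j.val) * c + k.val) * d + l.val) * f + q.val < (((i.val * b + j.val) * c + k.val) * d + l.val) * f + f := by omega
    _ = ((((i.val * b + j.val) * c + k.val) * d + l.val) + 1) * f := by ring
    _ ≤ (a * (b * (c * d))) * f := Nat.mul_le_mul_right f h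
    _ = a * (b * (c * (d * f))) := by ring

/-- `blocks₄ a b c d f v i j k l q = v ((((i·b + j)·c + k)·d + l)·f + q)`. [folklore] -/
theorem blocks₄_eq (a b c d f : ℕ) (v : Fin (a * (b * (c * (d * f)))) → α) (i : Fin a) (j : Fin b) (k : Fin c) (l : Fin d) (q : Fin f) :
    blocks₄ a b c d f v i j k l q = v ⟨(((i.val * b + j.val) * c + k.val) * d + l.val) * f + q.val, idx₄_lt i j k l q⟩ := by
  unfold blocks₄
  rw [blocks₃_eq, blocksOf_eq]
  congr 1
  exact Fin.ext (by simp; ring)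

/-- First segment of `split2`. [folklore] -/
theorem split2_fst (a b : ℕ) (v : Fin (a + b) → α) (i : Fin a) : (split2 a b v).1 i = v ⟨i.val, by omega⟩ := rfl

/-- Second segment of `split2`. [folklore] -/
theorem split2_snd (a b : ℕ) (v : Fin (a + b) → α) (j : Fin b) : (split2 a b v).2 j = v ⟨a + j.val, by omega⟩ := rfl

/-- Segments of `split3`. [folklore] -/
theorem split3_eq (a b c : ℕ) (v : Fin (a + (b + c)) → α) :
    (∀ i : Fin a, (split3 a b c v).1 i = v ⟨i.val, by omega⟩) ∧ (∀ j : Fin b, (split3 a b c v).2.1 j = v ⟨a + j.val, by omega⟩) ∧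
      (∀ k : Fin c, (split3 a b c v).2.2 k = v ⟨a + (b + k.val), by omega⟩) :=
  ⟨fun _ => rfl, fun _ => rfl, fun _ => rfl⟩

/-- Segments of `split4`. [folklore] -/
theorem split4_eq (a b c d : ℕ) (v : Fin (a + (b + (c + d))) → α) :
    (∀ i : Fin a, (split4 a b c d v).1 i = v ⟨i.val, by omega⟩) ∧ (∀ j : Fin b, (split4 a b c d v).2.1 j = v ⟨a + j.val, by omega⟩) ∧
      (∀ k : Fin c, (split4 a b c d v).2.2.1 k = v ⟨a + (b + k.val), by omega⟩) ∧
        (∀ q : Fin d, (split4 a b c d v).2.2.2 q = v ⟨a + (b + (c + q.val)), by omega⟩) :=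
  ⟨fun _ => rfl, fun _ => rfl, fun _ => rfl, fun _ => rfl⟩

/-- First two segments of `split8`. [folklore] -/
theorem split8_eq₁₂ (n₁ n₂ n₃ n₄ n₅ n₆ n₇ n₈ : ℕ) (v : Fin (n₁ + (n₂ + (n₃ + (n₄ + (n₅ + (n₆ + (n₇ + n₈))))))) → α) :
    (∀ i : Fin n₁, (split8 n₁ n₂ n₃ n₄ n₅ n₆ n₇ n₈ v).1 i = v ⟨i.val, by omega⟩) ∧
      (∀ j : Fin n₂, (split8 n₁ n₂ n₃ n₄ n₅ n₆ n₇ n₈ v).2.1 j = v ⟨n₁ + j.val, by omega⟩) :=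
  ⟨fun _ => rfl, fun _ => rfl⟩

/-- All segments of `split8`. [folklore] -/
theorem split8_eq (n₁ n₂ n₃ n₄ n₅ n₆ n₇ n₈ : ℕ) (v : Fin (n₁ + (n₂ + (n₃ + (n₄ + (n₅ + (n₆ + (n₇ + n₈))))))) → α) :
    (∀ i : Fin n₃, (split8 n₁ n₂ n₃ n₄ n₅ n₆ n₇ n₈ v).2.2.1 i = v ⟨n₁ + (n₂ + i.val), by omega⟩) ∧
      (∀ i : Fin n₄, (split8 n₁ n₂ n₃ n₄ n₅ n₆ n₇ n₈ v).2.2.2.1 i = v ⟨n₁ + (n₂ + (n₃ + i.val)), by omega⟩) ∧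
      (∀ i : Fin n₅, (split8 n₁ n₂ n₃ n₄ n₅ n₆ n₇ n₈ v).2.2.2.2.1 i = v ⟨n₁ + (n₂ + (n₃ + (n₄ + i.val))), by omega⟩) ∧
      (∀ i : Fin n₆, (split8 n₁ n₂ n₃ n₄ n₅ n₆ n₇ n₈ v).2.2.2.2.2.1 i = v ⟨n₁ + (n₂ + (n₃ + (n₄ + (n₅ + i.val)))), by omega⟩) ∧
      (∀ i : Fin n₇, (split8 n₁ n₂ n₃ n₄ n₅ n₆ n₇ n₈ v).2.2.2.2.2.2.1 i = v ⟨n₁ + (n₂ + (n₃ + (n₄ + (n₅ + (n₆ + i.val))))), by omega⟩) ∧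
      (∀ i : Fin n₈, (split8 n₁ n₂ n₃ n₄ n₅ n₆ n₇ n₈ v).2.2.2.2.2.2.2 i = v ⟨n₁ + (n₂ + (n₃ + (n₄ + (n₅ + (n₆ + (n₇ + i.val)))))), by omega⟩) :=
  ⟨fun _ => rfl, fun _ => rfl, fun _ => rfl, fun _ => rfl, fun _ => rfl, fun _ => rfl⟩

end Positions

/-! ### Coin chunks -/

section Chunks

/-- `bitsToNat (List.ofFn c) = ∑ᵢ cᵢ 2ⁱ`. [folklore] -/
theorem bitsToNat_ofFn : ∀ {e : ℕ} (c : Fin e → Bool), bitsToNat (List.ofFn c) = ∑ i : Fin e, (if c i then 1 else 0) * 2 ^ (i : ℕ)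
  | 0, c => by simp
  | e + 1, c => by
    rw [List.ofFn_succ, bitsToNat, bitsToNat_ofFn, Fin.sum_univ_succ]
    simp only [Fin.val_zero, pow_zero, mul_one, Fin.val_succ, pow_succ, Finset.mul_sum]
    congr 1
    · cases c 0 <;> simp
    · exact Finset.sum_congr rfl fun i _ => by ring

/-- **The uniform scalar of a chunk is the binary value of its coins.** [cite: AroraBarak2009, Def. 7.1] -/
theorem chunkVal_eq_bitsToNat {e : ℕ} (c : Fin e → Bool) : chunkVal e c = ((bitsToNat (List.ofFn c) : ℕ) : ZMod (2 ^ e)) := by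
  rw [chunkVal, val_chunkFin, bitsToNat_ofFn]

/-- `scalarsOf … rbits i` is the chunk at position `i·e`. [folklore] -/
theorem scalarsOf_eq (d e m N T N' : ℕ) (rbits : Fin (numScalars d e m N T N' * e) → Bool) (i : Fin (numScalars d e m N T N')) :
    scalarsOf d e m N T N' rbits i = chunkVal e fun t : Fin e => rbits ⟨i.val * e + t.val, by
      calc i.val * e + t.val < i.val * e + e := by omega
        _ = (i.val + 1) * e := by ring
        _ ≤ numScalars d e m N T N' * e := Nat.mul_le_mul_right e i.2⟩ := by
  unfold scalarsOf
  congr 1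
  funext t
  exact blocksOf_eq _ _ rbits i t

end Chunks

/-! ### Slices, chunks and indexed maps of `List.ofFn` -/

section OfFn

variable {α β : Type}

/-- **A slice of `List.ofFn`** is `List.ofFn` of the shifted index. [folklore] -/
theorem sliceAt_ofFn {n : ℕ} (f : Fin n → α) (off len : ℕ) (h : off + len ≤ n) :
    sliceAt (List.ofFn f) off len = List.ofFn fun t : Fin len => f ⟨off + t.val, by omega⟩ := by
  unfold sliceAt
  apply List.ext_getElem
  · simp; omega
  · intro i h₁ h₂
    simp

/-- **A slice of a long enough list as `List.ofFn` of `getD`.** [folklore] -/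
theorem sliceAt_eq_ofFn_getD (l : List α) (off len : ℕ) (dflt : α) (h : off + len ≤ l.length) :
    sliceAt l off len = List.ofFn fun t : Fin len => l.getD (off + t.val) dflt := by
  unfold sliceAt
  apply List.ext_getElem
  · simp; omega
  · intro i h₁ h₂
    simp only [List.getElem_take, List.getElem_drop, List.getElem_ofFn]
    rw [List.getD_eq_getElem _ _ (by simp at h₂; omega)]

/-- `strSliceAt` is `sliceAt`. [folklore] -/
theorem strSliceAt_eq (w : List Bool) (off len : ℕ) : strSliceAt w off len = sliceAt w off len := rfl

/-- **Chunks of `List.ofFn` over `Fin (k·u)`** are the consecutive blocks. [folklore] -/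
theorem chunks_ofFn {k u : ℕ} (hu : 0 < u) (g : Fin (k * u) → α) :
    chunks u (List.ofFn g) = List.ofFn fun i : Fin k => List.ofFn fun q : Fin u => g ⟨i.val * u + q.val, by
      calc i.val * u + q.val < i.val * u + u := by omega
        _ = (i.val + 1) * u := by ring
        _ ≤ k * u := Nat.mul_le_mul_right u i.2⟩ := by
  unfold chunks
  rw [List.length_ofFn, Nat.mul_div_cancel _ hu]
  apply List.ext_getElem
  · simp
  · intro i h₁ h₂
    simp only [List.getElem_map, List.getElem_range, List.getElem_ofFn]
    have hi : i < k := by simpa using h₂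
    rw [← sliceAt, sliceAt_ofFn g (i * u) u (by
      calc i * u + u = (i + 1) * u := by ring
        _ ≤ k * u := Nat.mul_le_mul_right u hi)]

/-- **Indexed map of `List.ofFn`.** [folklore] -/
theorem mapIdx_ofFn {n : ℕ} (f : Fin n → α) (h : ℕ → α → β) : (List.ofFn f).mapIdx h = List.ofFn fun i => h i (f i) := by
  apply List.ext_getElem
  · simp
  · intro i h₁ h₂
    simp

end OfFn

/-! ### The estimation accessors of the layout as explicit positions -/

section LayoutEst

variable (d e K' m N T N' m' ℓ : ℕ) (S : Fin (numSamples d e K' m N T N' m') → (Fin d → ZMod (2 ^ e)) × ZMod (2 ^ e))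
  (coins : Fin (numCoins d e m N T N' ℓ) → Bool) (j : Fin (e + 1)) (k : Fin N')

/-- The raw samples of estimation item `i` of unit `(j, k)`: positions `((j·N' + k)·m + i)·(K'+1) + q`.
[folklore] -/
theorem layout_est_smp (i : Fin m) (q : Fin (K' + 1)) :
    (((layout d e K' m N T N' m' ℓ (S, coins)).1 j k).1.1 i).1 q =
      S ⟨((j.val * N' + k.val) * m + i.val) * (K' + 1) + q.val, lt_of_lt_of_le (idx₃_lt j k i q) (Nat.le_add_right _ _)⟩ := by
  simp only [layout, regroupTop, Equiv.coe_fn_mk, Function.comp_apply, Prod.map_apply, Prod.map_fst, Prod.map_snd, estAssemble]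
  rw [blocks₃_eq]
  exact (split4_eq _ _ _ _ S).1 _

/-- The level scalar of estimation item `i` of unit `(j, k)`: scalar `(j·N' + k)·m + i`. [folklore] -/
theorem layout_est_lvl (i : Fin m) :
    (((layout d e K' m N T N' m' ℓ (S, coins)).1 j k).1.1 i).2 =
      scalarsOf d e m N T N' (split2 _ _ coins).1 ⟨(j.val * N' + k.val) * m + i.val, lt_of_lt_of_le (idx₂_lt j k i) (Nat.le_add_right _ _)⟩ := by
  simp only [layout, regroupTop, Equiv.coe_fn_mk, Function.comp_apply, Prod.map_apply, Prod.map_fst, Prod.map_snd, estAssemble]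
  rw [blocks₂_eq]
  exact (split8_eq₁₂ _ _ _ _ _ _ _ _ _).1 _

/-- The shift scalars of unit `(j, k)`: scalars `rEl + (j·N' + k)·d + cc`. [folklore] -/
theorem layout_est_shift (cc : Fin d) :
    ((layout d e K' m N T N' m' ℓ (S, coins)).1 j k).1.2 cc =
      scalarsOf d e m N T N' (split2 _ _ coins).1 ⟨rEl e m N' + ((j.val * N' + k.val) * d + cc.val),
        lt_of_lt_of_le (Nat.add_lt_add_left (idx₂_lt j k cc) _) (by unfold numScalars rEs; omega)⟩ := by
  simp only [layout, regroupTop, Equiv.coe_fn_mk, Function.comp_apply, Prod.map_apply, Prod.map_fst, Prod.map_snd, estAssemble]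
  rw [blocks₂_eq]
  exact (split8_eq₁₂ _ _ _ _ _ _ _ _ _).2 _

/-- The coin slice of unit `(j, k)`: coins `numScalars·e + (j·N' + k)·ℓ + t`. [folklore] -/
theorem layout_est_coin (t : Fin ℓ) :
    ((layout d e K' m N T N' m' ℓ (S, coins)).1 j k).2 t =
      coins ⟨numScalars d e m N T N' * e + ((j.val * N' + k.val) * ℓ + t.val),
        Nat.add_lt_add_left (lt_of_lt_of_le (idx₂_lt j k t) (Nat.le_add_right _ _)) _⟩ := by
  simp only [layout, regroupTop, Equiv.coe_fn_mk, Function.comp_apply, Prod.map_apply, Prod.map_fst, Prod.map_snd, estAssemble]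
  rw [blocks₂_eq, (split3_eq _ _ _ _).1, split2_snd]

end LayoutEst

/-! ### The digit accessors of the layout as explicit positions -/

section LayoutDig

variable (d e K' m N T N' m' ℓ : ℕ) (S : Fin (numSamples d e K' m N T N' m') → (Fin d → ZMod (2 ^ e)) × ZMod (2 ^ e))
  (coins : Fin (numCoins d e m N T N' ℓ) → Bool) (c : Fin d) (i' : Fin e) (k : Fin 2) (t : Fin T)

/-- The trial's position prefix `(((c·e + i')·2 + k)·T + t)` (all arguments natural numbers). [folklore] -/
def trialPos (e T c i' k t : ℕ) : ℕ := ((c * e + i') * 2 + k) * T + t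

/-- The trial's position prefix is the `blocks₄` position. [folklore] -/
theorem trialPos_eq : trialPos e T c.val i'.val k.val t.val = ((c.val * e + i'.val) * 2 + k.val) * T + t.val := rfl

/-- Bound on the trial's position prefix. [folklore] -/
theorem trialPos_lt : trialPos e T c.val i'.val k.val t.val < d * (e * (2 * T)) := by
  have := idx₃_lt c i' k t
  unfold trialPos
  omega

/-- The worst-case shift scalars of the trial. [folklore] -/
theorem layout_dig_tau (cc : Fin d) :
    ((layout d e K' m N T N' m' ℓ (S, coins)).2.1 c i' k t).1 cc =
      scalarsOf d e m N T N' (split2 _ _ coins).1 ⟨rEl e m N' + (rEs d e N' + (rX d e m N T + (rX d e m N T + (rX d e m N T +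
        (rX d e m N T + (rX d e m N T + (trialPos e T c.val i'.val k.val t.val * d + cc.val))))))), by
          have := idx₄_lt c i' k t cc; unfold numScalars rTau trialPos; omega⟩ := by
  simp only [layout, regroupTop, Equiv.coe_fn_mk, Function.comp_apply, Prod.map_apply, Prod.map_fst, Prod.map_snd, digAssemble,
    regroupDig, zipLeaf4, nest4, id_eq]
  rw [blocks₄_eq]
  rw [(split8_eq _ _ _ _ _ _ _ _ _).2.2.2.2.2]
  rfl

/-- The raw samples of `x`-item `(b, q)` of the trial: positions `nEs + trialPos·(N·m·(K'+1)) + (b·m + q)·(K'+1) + q'`. [folklore] -/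
theorem layout_dig_xs (b : Fin N) (q : Fin m) (q' : Fin (K' + 1)) :
    (((layout d e K' m N T N' m' ℓ (S, coins)).2.1 c i' k t).2.1.1 b q).2.1 q' =
      S ⟨nEs e K' m N' + (trialPos e T c.val i'.val k.val t.val * (N * (m * (K' + 1))) + ((b.val * m + q.val) * (K' + 1) + q'.val)), by
        have h1 := idx₄_lt c i' k t (⟨(b.val * m + q.val) * (K' + 1) + q'.val, idx₂_lt b q q'⟩ : Fin (N * (m * (K' + 1))))
        unfold numSamples nXs trialPos; simp at h1; omega⟩ := by
  simp only [layout, regroupTop, Equiv.coe_fn_mk, Function.comp_apply, Prod.map_apply, Prod.map_fst, Prod.map_snd, digAssemble,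
    regroupDig, zipLeaf4, nest4, zip2, id_eq]
  rw [blocks₂_eq, blocks₄_eq, (split4_eq _ _ _ _ S).2.1]
  rfl

/-- Bound for a digit scalar position. [folklore] -/
theorem dig_scalar_lt (b : Fin N) (q : Fin m) : trialPos e T c.val i'.val k.val t.val * (N * m) + (b.val * m + q.val) < rX d e m N T := by
  have h0 := idx₂_lt b q (⟨0, Nat.one_pos⟩ : Fin 1)
  simp at h0
  have h1 := idx₄_lt c i' k t (⟨b.val * m + q.val, h0⟩ : Fin (N * m))
  unfold rX trialPos; simp at h1; omega

/-- The transform scalar `l` of `x`-item `(b, q)`. [folklore] -/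
theorem layout_dig_xl (b : Fin N) (q : Fin m) :
    (((layout d e K' m N T N' m' ℓ (S, coins)).2.1 c i' k t).2.1.1 b q).1 =
      scalarsOf d e m N T N' (split2 _ _ coins).1 ⟨rEl e m N' + (rEs d e N' + (trialPos e T c.val i'.val k.val t.val * (N * m) + (b.val * m + q.val))), by
        have := dig_scalar_lt d e m N T c i' k t b q; unfold numScalars; omega⟩ := by
  simp only [layout, regroupTop, Equiv.coe_fn_mk, Function.comp_apply, Prod.map_apply, Prod.map_fst, Prod.map_snd, digAssemble,
    regroupDig, zipLeaf4, nest4, zip2, id_eq]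
  rw [blocksOf_eq, blocks₄_eq, (split8_eq _ _ _ _ _ _ _ _ _).1]
  rfl

/-- The level scalar `r` of `x`-item `(b, q)`. [folklore] -/
theorem layout_dig_xr (b : Fin N) (q : Fin m) :
    (((layout d e K' m N T N' m' ℓ (S, coins)).2.1 c i' k t).2.1.1 b q).2.2 =
      scalarsOf d e m N T N' (split2 _ _ coins).1 ⟨rEl e m N' + (rEs d e N' + (rX d e m N T +
        (trialPos e T c.val i'.val k.val t.val * (N * m) + (b.val * m + q.val)))), by
        have := dig_scalar_lt d e m N T c i' k t b q; unfold numScalars; omega⟩ := by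
  simp only [layout, regroupTop, Equiv.coe_fn_mk, Function.comp_apply, Prod.map_apply, Prod.map_fst, Prod.map_snd, digAssemble,
    regroupDig, zipLeaf4, nest4, zip2, id_eq]
  rw [blocksOf_eq, blocks₄_eq, (split8_eq _ _ _ _ _ _ _ _ _).2.1]
  rfl

/-- The re-spread scalar `ρ` of `y`-item `(b, q)`. [folklore] -/
theorem layout_dig_yρ (b : Fin N) (q : Fin m) :
    (((layout d e K' m N T N' m' ℓ (S, coins)).2.1 c i' k t).2.1.2 b q).1 =
      scalarsOf d e m N T N' (split2 _ _ coins).1 ⟨rEl e m N' + (rEs d e N' + (rX d e m N T + (rX d e m N T +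
        (trialPos e T c.val i'.val k.val t.val * (N * m) + (b.val * m + q.val))))), by
        have := dig_scalar_lt d e m N T c i' k t b q; unfold numScalars; omega⟩ := by
  simp only [layout, regroupTop, Equiv.coe_fn_mk, Function.comp_apply, Prod.map_apply, Prod.map_fst, Prod.map_snd, digAssemble,
    regroupDig, zipLeaf4, nest4, zip2, id_eq]
  rw [blocksOf_eq, blocks₄_eq, (split8_eq _ _ _ _ _ _ _ _ _).2.2.1]
  rfl

/-- The transform scalar `l` of `y`-item `(b, q)`. [folklore] -/
theorem layout_dig_yl (b : Fin N) (q : Fin m) :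
    (((layout d e K' m N T N' m' ℓ (S, coins)).2.1 c i' k t).2.1.2 b q).2.1 =
      scalarsOf d e m N T N' (split2 _ _ coins).1 ⟨rEl e m N' + (rEs d e N' + (rX d e m N T + (rX d e m N T + (rX d e m N T +
        (trialPos e T c.val i'.val k.val t.val * (N * m) + (b.val * m + q.val)))))), by
        have := dig_scalar_lt d e m N T c i' k t b q; unfold numScalars; omega⟩ := by
  simp only [layout, regroupTop, Equiv.coe_fn_mk, Function.comp_apply, Prod.map_apply, Prod.map_fst, Prod.map_snd, digAssemble,
    regroupDig, zipLeaf4, nest4, zip2, id_eq]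
  rw [blocksOf_eq, blocks₄_eq, (split8_eq _ _ _ _ _ _ _ _ _).2.2.2.1]
  rfl

/-- The raw samples of `y`-item `(b, q)`: positions `nEs + nXs + trialPos·(N·m·(K'+1)) + (b·m + q)·(K'+1) + q'`. [folklore] -/
theorem layout_dig_ys (b : Fin N) (q : Fin m) (q' : Fin (K' + 1)) :
    (((layout d e K' m N T N' m' ℓ (S, coins)).2.1 c i' k t).2.1.2 b q).2.2.1 q' =
      S ⟨nEs e K' m N' + (nXs d e K' m N T + (trialPos e T c.val i'.val k.val t.val * (N * (m * (K' + 1))) +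
        ((b.val * m + q.val) * (K' + 1) + q'.val))), by
        have h1 := idx₄_lt c i' k t (⟨(b.val * m + q.val) * (K' + 1) + q'.val, idx₂_lt b q q'⟩ : Fin (N * (m * (K' + 1))))
        unfold numSamples nXs trialPos; simp at h1; omega⟩ := by
  simp only [layout, regroupTop, Equiv.coe_fn_mk, Function.comp_apply, Prod.map_apply, Prod.map_fst, Prod.map_snd, digAssemble,
    regroupDig, zipLeaf4, nest4, zip2, id_eq]
  rw [blocks₂_eq, blocks₄_eq, (split4_eq _ _ _ _ S).2.2.1]
  rfl

/-- The level scalar `r` of `y`-item `(b, q)`. [folklore] -/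
theorem layout_dig_yr (b : Fin N) (q : Fin m) :
    (((layout d e K' m N T N' m' ℓ (S, coins)).2.1 c i' k t).2.1.2 b q).2.2.2 =
      scalarsOf d e m N T N' (split2 _ _ coins).1 ⟨rEl e m N' + (rEs d e N' + (rX d e m N T + (rX d e m N T + (rX d e m N T + (rX d e m N T +
        (trialPos e T c.val i'.val k.val t.val * (N * m) + (b.val * m + q.val))))))), by
        have := dig_scalar_lt d e m N T c i' k t b q; unfold numScalars; omega⟩ := by
  simp only [layout, regroupTop, Equiv.coe_fn_mk, Function.comp_apply, Prod.map_apply, Prod.map_fst, Prod.map_snd, digAssemble,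
    regroupDig, zipLeaf4, nest4, zip2, id_eq]
  rw [blocksOf_eq, blocks₄_eq, (split8_eq _ _ _ _ _ _ _ _ _).2.2.2.2.1]
  rfl

/-- Bound for a digit coin position. [folklore] -/
theorem dig_coin_lt (b : Fin N) (tt : Fin ℓ) : trialPos e T c.val i'.val k.val t.val * (N * ℓ) + (b.val * ℓ + tt.val) < cX d e N T ℓ := by
  have h0 := idx₂_lt b tt (⟨0, Nat.one_pos⟩ : Fin 1)
  simp at h0
  have h1 := idx₄_lt c i' k t (⟨b.val * ℓ + tt.val, h0⟩ : Fin (N * ℓ))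
  unfold cX trialPos; simp at h1; omega

/-- The coin slice of the `x`-call `b` of the trial. [folklore] -/
theorem layout_dig_cx (b : Fin N) (tt : Fin ℓ) :
    ((layout d e K' m N T N' m' ℓ (S, coins)).2.1 c i' k t).2.2.1 b tt =
      coins ⟨numScalars d e m N T N' * e + (cE e N' ℓ + (trialPos e T c.val i'.val k.val t.val * (N * ℓ) + (b.val * ℓ + tt.val))), by
        have := dig_coin_lt d e N T ℓ c i' k t b tt; unfold numCoins numCallBits; omega⟩ := by
  simp only [layout, regroupTop, Equiv.coe_fn_mk, Function.comp_apply, Prod.map_apply, Prod.map_fst, Prod.map_snd, digAssemble,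
    regroupDig, zipLeaf4, nest4, id_eq]
  rw [blocksOf_eq, blocks₄_eq, (split3_eq _ _ _ _).2.1, split2_snd]
  rfl

/-- The coin slice of the `y`-call `b` of the trial. [folklore] -/
theorem layout_dig_cy (b : Fin N) (tt : Fin ℓ) :
    ((layout d e K' m N T N' m' ℓ (S, coins)).2.1 c i' k t).2.2.2 b tt =
      coins ⟨numScalars d e m N T N' * e + (cE e N' ℓ + (cX d e N T ℓ + (trialPos e T c.val i'.val k.val t.val * (N * ℓ) + (b.val * ℓ + tt.val)))), by
        have := dig_coin_lt d e N T ℓ c i' k t b tt; unfold numCoins numCallBits; omega⟩ := by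
  simp only [layout, regroupTop, Equiv.coe_fn_mk, Function.comp_apply, Prod.map_apply, Prod.map_fst, Prod.map_snd, digAssemble,
    regroupDig, zipLeaf4, nest4, id_eq]
  rw [blocksOf_eq, blocks₄_eq, (split3_eq _ _ _ _).2.2, split2_snd]
  rfl

end LayoutDig

/-! ### The top samples of the layout -/

section LayoutTop

variable (d e K' m N T N' m' ℓ : ℕ) (S : Fin (numSamples d e K' m N T N' m') → (Fin d → ZMod (2 ^ e)) × ZMod (2 ^ e))
  (coins : Fin (numCoins d e m N T N' ℓ) → Bool)

/-- The top samples: positions `nEs + nXs + nXs + i`. [folklore] -/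
theorem layout_top (i : Fin m') :
    (layout d e K' m N T N' m' ℓ (S, coins)).2.2 i = S ⟨nEs e K' m N' + (nXs d e K' m N T + (nXs d e K' m N T + i.val)), by unfold numSamples; omega⟩ := by
  simp only [layout, regroupTop, Equiv.coe_fn_mk, Prod.map_apply]
  exact (split4_eq _ _ _ _ S).2.2.2 i

end LayoutTop

/-! ### Representatives -/

section Val

variable {Q : ℕ} [NeZero Q]

/-- **The representative of a sum** is the sum of representatives reduced. [folklore] -/
theorem val_sum {ι : Type} (s : Finset ι) (f : ι → ZMod Q) : (∑ i ∈ s, f i).val = (∑ i ∈ s, (f i).val) % Q := by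
  have h : (((∑ i ∈ s, (f i).val) % Q : ℕ) : ZMod Q) = ∑ i ∈ s, f i := by
    rw [ZMod.natCast_mod, Nat.cast_sum]
    exact Finset.sum_congr rfl fun i _ => ZMod.natCast_zmod_val (f i)
  have := congrArg ZMod.val h
  rwa [ZMod.val_natCast, Nat.mod_mod, eq_comm] at this

omit [NeZero Q] in
/-- A natural number below the modulus is the representative of its residue. [folklore] -/
theorem eq_val_of_cast_eq {x : ℕ} {y : ZMod Q} (hx : x < Q) (h : ((x : ℕ) : ZMod Q) = y) : x = y.val := by
  rw [← h, ZMod.val_natCast, Nat.mod_eq_of_lt hx]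

/-- `Q - (x mod Q)` is `-x` as a residue. [folklore] -/
theorem cast_sub_mod (x : ℕ) : (((Q - x % Q : ℕ)) : ZMod Q) = -((x : ℕ) : ZMod Q) := by
  rw [Nat.cast_sub (Nat.mod_lt x (NeZero.pos Q)).le, ZMod.natCast_self, ZMod.natCast_mod, zero_sub]

/-- The representative of a power of two mod `2ᵉ`. [folklore] -/
theorem val_two_pow (e k : ℕ) : ((2 : ZMod (2 ^ e)) ^ k).val = 2 ^ k % 2 ^ e := by
  rw [show (2 : ZMod (2 ^ e)) = ((2 : ℕ) : ZMod (2 ^ e)) by norm_num, ← Nat.cast_pow, ZMod.val_natCast]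

end Val

end Prog

end MP12

end LWE

end Literature.Computability.Cryptography
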